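import Mathlib
import HarnessLib.Audit
import HarnessLib

/-!
# ROUND-16, ADDENDUM B (nsreg-p2, gen 18) — `SelfSimilarEtaBudget`: the local swirl-contrast
formula and the contrast–exponent conjecture in the `(-1)`-homogeneous axisymmetric class

Setting (`ν = 1`, `c = cos ϑ`).  A `(-1)`-homogeneous axisymmetric poloidal field is
`u = ∇ × (ψ/(ρ sin ϑ) e_φ)` with `ψ = ρ·q(c)`, `q(±1) = 0`; then `ρ u_ρ = -q'(c)` (INFLOW where
`q' > 0`), `ρ sin ϑ · u_ϑ = -q(c)`, and `η = ω_φ / r = -q''(c)/ρ³`.  The steady `η`-equation with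
swirl source, `u·∇η - (Δ + (2/r)∂_r) η = ∂_z(Θ²)/r⁴`, forces along every vertical line

  `Θ²(c) = Θ₀² + F[q](c)`,
  `F[q](c) = -(1/2)(1-c²)(q²)'' - c (q²)' + q² + (1-c²)² q'''`            (`ssContrast`)

because the inertial residual is the pure third derivative `-(q²)'''/2` and the viscous one is
`[(1-c²)² q''']'/(1-c²)` (sympy certificates: kit j272512 part A — both identities and the match
with ROUND-16's funnel polynomial of kit j272044; kit j272830 — `F ≡ 0` on the whole Landau family
`q_A = 2(1-c²)/(A-c)`, the exact steady swirl-free solutions, and `F = 3a²(1-c²)²` on the Stokeslet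
`q = a(1-c²)`, kernel-checked below as `ssContrast_stokeslet`).  Hence a steady self-similar swirl
needs `sup Θ² ≥ osc_{[-1,1]} F[q]` (`ssContrastOsc`).

The PASSIVE EXPONENT of the profile (ROUND-15's funnel exponent, general `q`): separable steady
solutions `Θ = ρ^γ G(c)` of `u·∇Θ = ΔΘ - (2/r)∂_rΘ` are exactly the solutions of
`(1-c²)G'' - q G' + (γ(γ-1) + γ q') G = 0`, `G(±1) = 0`; `IsPassiveExponent q γ` asks for a
positive (nodeless) one (`isPassiveExponent_rest`: `q = 0 ↦ γ = 2`, `G = 1-c²`; kit j272675: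
funnel `q = (N/2)c(1-c²)` ↦ `γ(8) = 0.49`, `γ(16) = 0.066`, `γ(32) = 0.0013`, matching ROUND-15).

Kit j272512/j272675 show that the NAIVE budget (contrast per inflow Péclet²) has infimum `0`, attained
by inflow ALONG THE AXIS (`c = ±1`, where `Θ ∼ r²` is free) — and that such profiles have
`γ ≈ 2` (harmless: axis fluid carries `Θ = 0`).  The meaningful statement pairs the two functionals:

  `SelfSimilarContrastExponentIneq`:  `γ ≥ exp(-C(1 + √(osc F[q])))` for every passive exponent.

For the funnel `osc F ≈ 0.52N²` and `γ ≈ e^{-N/4}`, i.e. `γ ≈ e^{-0.35√(osc F)}`: the conjecture says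
the funnel is extremal up to the constant.  Kit j272675 part (3) — `W(g₀) = min {osc F[q] : γ[q] ≤ g₀}`
over degree-12 Chebyshev profiles, 11 starts each (funnels, oblique cones, two-sheet profiles):
`W(1) = 9.23` (funnel `21.8`), `W(0.5) = 16.98` (funnel `49.3`), `W(0.25) = 35.5` (funnel `82.5`) —
ratios `0.42 / 0.34 / 0.43`, no trend to `0`, every minimiser FUNNEL-LIKE (equatorial inflow sheet
at `c = 0`, polar outflow jets); fit `√W ≈ 3.0 + 2.1·log(1/g₀)`, i.e. `γ ≳ e^{1.4}·e^{-0.47√(osc F)}`: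
the conjecture stands on the optimised profiles with `C ≈ 0.5` (kit j273589 extends to `g₀ = 0.01`).
With `osc F ≤ sup Θ² ≤ R_Γ²` this is the self-similar shadow of ROUND-16's profile
`ExpSwirlGaugedLaw 1` (`γ₁(S) ≳ e^{-C S}`).

hard core evaded: all eight — pure ODE/real analysis about a model class; no NS statement.
-/

namespace Summit.NavierStokesRegularity.NavierStokesRegularity.Theorems.SelfSimilarEtaBudget

open Set Real

/-- The local swirl-contrast formula `F[q](c)` of the `(-1)`-homogeneous class (memo ADDENDUM B). -/
noncomputable def ssContrast (q : ℝ → ℝ) (c : ℝ) : ℝ :=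
  -(1/2) * (1 - c ^ 2) * iteratedDeriv 2 (fun x => q x ^ 2) c - c * deriv (fun x => q x ^ 2) c
    + q c ^ 2 + (1 - c ^ 2) ^ 2 * iteratedDeriv 3 q c

/-- Its oscillation over `[-1,1]` = the minimal swirl contrast `sup Θ² - inf Θ²` a steady
self-similar swirl must carry on top of the poloidal profile `q`. -/
noncomputable def ssContrastOsc (q : ℝ → ℝ) : ℝ :=
  sSup (ssContrast q '' Icc (-1) 1) - sInf (ssContrast q '' Icc (-1) 1)

/-- The inflow Péclet number of the profile: `sup_c (ρ u_ρ)⁻ = sup_{[-1,1]} q'`. -/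
noncomputable def ssInflowPeclet (q : ℝ → ℝ) : ℝ :=
  sSup ((fun c => deriv q c) '' Icc (-1) 1)

/-- `γ > 0` is a PASSIVE EXPONENT of the profile `q`: the separable steady swirl equation in the
drift of `q` has a positive solution `ρ^γ G(cos ϑ)` vanishing on the axis. -/
def IsPassiveExponent (q : ℝ → ℝ) (γ : ℝ) : Prop :=
  0 < γ ∧ ∃ G : ℝ → ℝ, ContDiff ℝ 2 G ∧ G 1 = 0 ∧ G (-1) = 0 ∧ (∀ c ∈ Ioo (-1 : ℝ) 1, 0 < G c) ∧
    ∀ c ∈ Ioo (-1 : ℝ) 1,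
      (1 - c ^ 2) * iteratedDeriv 2 G c - q c * deriv G c + (γ * (γ - 1) + γ * deriv q c) * G c = 0

/-! ### Kernel checks of the two functionals on the explicit profiles -/

/-- Calculus helper (`hasDerivAt_sq_stokeslet`). -/
private lemma hasDerivAt_sq_stokeslet (a x : ℝ) :
    HasDerivAt (fun x : ℝ => (a * (1 - x ^ 2)) ^ 2) (-4 * a ^ 2 * x + 4 * a ^ 2 * x ^ 3) x := by
  have h := (((hasDerivAt_pow 2 x).const_sub 1).const_mul a).pow 2
  exact h.congr_deriv (by ring)

/-- Calculus helper (`deriv_sq_stokeslet`). -/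
private lemma deriv_sq_stokeslet (a : ℝ) :
    deriv (fun x : ℝ => (a * (1 - x ^ 2)) ^ 2) = fun x => -4 * a ^ 2 * x + 4 * a ^ 2 * x ^ 3 :=
  funext fun x => (hasDerivAt_sq_stokeslet a x).deriv

/-- Calculus helper (`hasDerivAt_dsq_stokeslet`). -/
private lemma hasDerivAt_dsq_stokeslet (a x : ℝ) :
    HasDerivAt (fun x : ℝ => -4 * a ^ 2 * x + 4 * a ^ 2 * x ^ 3) (a ^ 2 * (12 * x ^ 2 - 4)) x := by
  have h := ((hasDerivAt_id' x).const_mul (-4 * a ^ 2)).add ((hasDerivAt_pow 3 x).const_mul (4 * a ^ 2))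
  exact h.congr_deriv (by ring)

/-- Calculus helper (`iteratedDeriv_two_sq_stokeslet`). -/
private lemma iteratedDeriv_two_sq_stokeslet (a c : ℝ) :
    iteratedDeriv 2 (fun x : ℝ => (a * (1 - x ^ 2)) ^ 2) c = a ^ 2 * (12 * c ^ 2 - 4) := by
  rw [iteratedDeriv_succ, iteratedDeriv_one, deriv_sq_stokeslet]
  exact (hasDerivAt_dsq_stokeslet a c).deriv

/-- Calculus helper (`hasDerivAt_stokeslet`). -/
private lemma hasDerivAt_stokeslet (a x : ℝ) :
    HasDerivAt (fun x : ℝ => a * (1 - x ^ 2)) (-2 * a * x) x := by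
  have h := ((hasDerivAt_pow 2 x).const_sub 1).const_mul a
  exact h.congr_deriv (by ring)

/-- Calculus helper (`deriv_stokeslet`). -/
private lemma deriv_stokeslet (a : ℝ) :
    deriv (fun x : ℝ => a * (1 - x ^ 2)) = fun x => -2 * a * x :=
  funext fun x => (hasDerivAt_stokeslet a x).deriv

/-- Calculus helper (`hasDerivAt_lin`). -/
private lemma hasDerivAt_lin (b x : ℝ) : HasDerivAt (fun x : ℝ => b * x) b x := by
  have h := (hasDerivAt_id' x).const_mul b
  exact h.congr_deriv (by ring)

/-- Calculus helper (`deriv_lin`). -/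
private lemma deriv_lin (b : ℝ) : deriv (fun x : ℝ => b * x) = fun _ => b :=
  funext fun x => (hasDerivAt_lin b x).deriv

/-- Calculus helper (`iteratedDeriv_three_stokeslet`). -/
private lemma iteratedDeriv_three_stokeslet (a c : ℝ) :
    iteratedDeriv 3 (fun x : ℝ => a * (1 - x ^ 2)) c = 0 := by
  rw [iteratedDeriv_succ, iteratedDeriv_succ, iteratedDeriv_one, deriv_stokeslet, deriv_lin]
  simp

/-- KERNEL CHECK 1 (Stokeslet, = kit j272830): `F[a(1-c²)] = 3a²(1-c²)²` — zero viscous cost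
(the third derivative of `q` vanishes: an exact Stokes flow) and inertial cost `3a²`. -/
theorem ssContrast_stokeslet (a c : ℝ) :
    ssContrast (fun x => a * (1 - x ^ 2)) c = 3 * a ^ 2 * (1 - c ^ 2) ^ 2 := by
  unfold ssContrast
  rw [iteratedDeriv_two_sq_stokeslet, iteratedDeriv_three_stokeslet, deriv_sq_stokeslet]
  ring

/-- Calculus helper (`hasDerivAt_rest`). -/
private lemma hasDerivAt_rest (x : ℝ) : HasDerivAt (fun x : ℝ => 1 - x ^ 2) (-2 * x) x := by
  have h := (hasDerivAt_pow 2 x).const_sub 1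
  exact h.congr_deriv (by ring)

/-- Calculus helper (`iteratedDeriv_two_rest`). -/
private lemma iteratedDeriv_two_rest (c : ℝ) : iteratedDeriv 2 (fun x : ℝ => 1 - x ^ 2) c = -2 := by
  rw [iteratedDeriv_succ, iteratedDeriv_one,
    show deriv (fun x : ℝ => 1 - x ^ 2) = fun x => -2 * x from funext fun x => (hasDerivAt_rest x).deriv,
    deriv_lin]

/-- KERNEL CHECK 2 (fluid at rest, = kit j272675 `gamma[q=0] = 2`): with no drift the passive
exponent is the smooth value `2`, carried by `G = 1 - c² = sin²ϑ` (`Θ = r²`). -/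
theorem isPassiveExponent_rest : IsPassiveExponent (fun _ => 0) 2 := by
  refine ⟨by norm_num, fun c => 1 - c ^ 2, by fun_prop, by norm_num, by norm_num, ?_, ?_⟩
  · intro c hc
    have h1 := hc.1
    have h2 := hc.2
    nlinarith
  · intro c _
    rw [iteratedDeriv_two_rest]
    simp only [deriv_const', mul_zero, add_zero, zero_mul, sub_zero]
    ring

/-- The ground passive exponent of a profile (an infimum; `= 2` at rest, `→ 0` exponentially
along ROUND-15's funnel family by kit j272675). -/
noncomputable def ssGroundExponent (q : ℝ → ℝ) : ℝ :=
  sInf {γ : ℝ | IsPassiveExponent q γ}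

/-- ROUND-16 ADDENDUM B — the SELF-SIMILAR CONTRAST–EXPONENT INEQUALITY (open; the self-similar
shadow of `SwirlGaugedTower.ExpSwirlGaugedLaw 1`): a bad passive Hölder exponent at the axis
point forces a large swirl contrast, at the exponential rate realised by the funnel
(`γ_funnel ≈ e^{-0.35 √(osc F)}`).  Profiles with inflow along the axis have small contrast but
`γ ≈ 2` (kit j272675), so the inequality is not threatened by them; at prescribed `γ ≤ g₀`
(`g₀ = 1, 0.5, 0.25`) the cheapest profiles found are funnel-like with `0.34–0.43` of the funnel's
contrast (kit j272675 part 3), consistent with `C ≈ 0.5`. -/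
@[conjecture]
def SelfSimilarContrastExponentIneq : Prop :=
  ∃ C : ℝ, 0 < C ∧ ∀ q : ℝ → ℝ, ContDiff ℝ 3 q → q 1 = 0 → q (-1) = 0 →
    ∀ γ : ℝ, IsPassiveExponent q γ → Real.exp (-(C * (1 + Real.sqrt (ssContrastOsc q)))) ≤ γ

/-- The same with the physical normalisation made explicit: contrast bounded by the squared swirl
Reynolds number `S²` gives an exponent floor `e^{-C(1+S)}` — the statement ROUND-16 §1c predicts. -/
theorem exponent_floor_of_contrast_le (h : SelfSimilarContrastExponentIneq) :
    ∃ C : ℝ, 0 < C ∧ ∀ q : ℝ → ℝ, ContDiff ℝ 3 q → q 1 = 0 → q (-1) = 0 →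
      ∀ S : ℝ, 0 ≤ S → ssContrastOsc q ≤ S ^ 2 →
        ∀ γ : ℝ, IsPassiveExponent q γ → Real.exp (-(C * (1 + S))) ≤ γ := by
  obtain ⟨C, hC, hq⟩ := h
  refine ⟨C, hC, fun q h3 h1 h1' S hS hle γ hγ => le_trans ?_ (hq q h3 h1 h1' γ hγ)⟩
  apply Real.exp_le_exp.mpr
  have : Real.sqrt (ssContrastOsc q) ≤ S := by
    calc Real.sqrt (ssContrastOsc q) ≤ Real.sqrt (S ^ 2) := Real.sqrt_le_sqrt hle
      _ = S := Real.sqrt_sq hS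
  nlinarith

end Summit.NavierStokesRegularity.NavierStokesRegularity.Theorems.SelfSimilarEtaBudget
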